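import Summits.Ventures.LatticeQCDFlow.Scaling.LadderRobinMode
import Summits.Ventures.LatticeQCDFlow.Scaling.HomLadderOneLevelModes
import Summits.Ventures.LatticeQCDFlow.Scaling.ApproximateEigenfunctionFloor
import Summits.Ventures.LatticeQCDFlow.Scaling.ExchangeSchemeHandoverCeiling
import Summits.Ventures.LatticeQCDFlow.Scaling.ReplicaExchangeBareErgodic

/-!
HONEST FRAMING: exact (Metropolis-corrected) sampling algorithms for lattice gauge theory; figures
of merit are autocorrelation/cost numbers at stated couplings and volumes; no continuum-physics
claim.

# HomLadderWilsonFloor — THE HOMOGENEOUS LADDER'S LAW-FREE `K³·log K` MIXING FLOOR: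
# **`t_mix(1/4) ≥ (K(2K+1)²/(π²t) − 1)·(½·log(K+1) − log(24√5))`** FOR EVERY CONTENT LAW WITH SOME `ν(u) ≤ ½`, EVERY HOT RATE `h = (1−t)w_0 > 0`, EVERY `K ≥ 2`,
# UNCONDITIONALLY IN THE CHAIN (the scheme is irreducible from the hot redraw and aperiodic); THE SAME FOR `ptBareSampler` (uniform update weights) (lean-2 GEN-47, ours)

Venture-side (OURS).  Cell `lqcd-flow` (pub-lqcd), unit `pub-lqcd-lean-2-g47`, 2026-08-31.  Chapter AG, file 3 — the assembly.  Setting of file 2: the weighted homogeneous ladder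
`P = t·ptBareSwap ν^{⊗} + (1−t)·prodKernel w M` over `K+1` levels with one positive law `ν`, exact hot sampler, idle cold kernels, `0 < t < 1`, `w_0 > 0`.  With the Robin mode
`c` of file 1 (rate `ρ`, `0 < ρ < 1`) and the centred indicator `a = 𝟙{· = u} − ν(u)`, the one-level sum `Φ(x) = Σ_kc_k·a(x_k)` is an EXACT eigenfunction `PΦ = (1−ρ)Φ` (file 2)
with Wilson increments `R ≤ tθ² + h·c_0² ≤ 5(K+1)ρ` (file 1), and `Φ(u,…,u) = (1−ν(u))Σ_kc_k ≥ (K+1)/6` when `ν(u) ≤ ½`; chapter AF file 1 (Levin–Peres–Wilmer Thm 13.28, D. B. Wilson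
2004, at defect `δ = 0`) with `D² = 5(K+1)` gives `t_mix(1/4) ≥ ((1−ρ)/ρ)·log(√(K+1)/(24√5))` and `1/ρ ≥ K(2K+1)²/(π²t)`.  The chain's convergence (needed by Prop. 7.9's use of
`t_mix`) is discharged here: the scheme is row-stochastic, `ν^{⊗}`-reversible, irreducible (a content reaches any level by a hot redraw and accepted swaps — the conveyor identity of
`Scaling/ReplicaExchangeBareErgodic`) and aperiodic (the hot redraw holds with probability `(1−t)w_0ν(x_0) > 0`), so LPW Thm 4.9 applies.  Hypothesis-equation `hP` for the kernel; no
definitions.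

* §1 `homLadder_kernels` (the replica kernels are stochastic and `ν`-reversible), **`homLadder_isRowStochastic`**, **`homLadder_detailedBalance`**, `homLadder_hot_pos`, `homLadder_swap_pos`,
  **`homLadder_isIrreducible`**, **`homLadder_isAperiodic`**, **`homLadder_exists_worstTvDist_le`**.
* §2 `centredIndicator_mean`, `centredIndicator_diff_sq_le`, **`homLadder_mode_mixingTime_ge`** (the floor at a given Robin root `θ`: `((1−ρ)/ρ)·log(√(K+1)/(24√5)) ≤ t_mix(1/4)`),
  **`homLadder_mixingTime_ge`** — **`(K(2K+1)²/(π²t) − 1)·(½·log(K+1) − log(24√5)) ≤ t_mix(1/4)`**, law-free and `h`-free; `homLadder_mixingTime_ge_lambda` (the kernel written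
  out); **`ptBareSampler_hom_mixingTime_ge`** (uniform update weights `1/(K+1)`, chapter R's sampler).

Reading (no numerics implied): with perfect adjacent transports (one law at every level in level coordinates) the replica-exchange LADDER needs order `(K³/t)·log K` steps to forget a
constant cold start, whatever the hot refresh rate — a `log K` above the cubic relaxation time of chapter I file 14 (`Gap ≥ t/(6K²(K+1))`), by the mechanism of D. B. Wilson's lower
bound for random adjacent transpositions; against chapter L ∕ M (the hub: `Θ(K·log K)` two-sided) the ladder's swap channel costs a factor `K²`.  NOT CLAIMED: the matching ceiling
(`O((K³/t)·log K)` is expected from the same mode as a positive supersolution on the stale set — not typed); flow ladders with imperfect transports.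
Literature grade (cell rule): OWN (LPW §13.5 ∕ Wilson 2004 mechanism, typed in chapter AF file 1; LPW Thm 4.9 typed under `Literature/`); nothing new cited; no new bib keys.
-/

noncomputable section

open Finset Function Real
open Literature.Probability.MarkovChains

namespace Summit.Ventures.LatticeQCDFlow.Scaling

variable {S : Type*} [Fintype S] [DecidableEq S] {K : ℕ} {ν : S → ℝ} {M : Fin (K + 1) → S → S → ℝ} {w : Fin (K + 1) → ℝ} {t : ℝ}
  {P : (Fin (K + 1) → S) → (Fin (K + 1) → S) → ℝ}

/-! ## §1 The homogeneous ladder converges -/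

/-- The replica kernels (exact hot redraw, idle cold kernels) are transition matrices in detailed balance with `ν`. [ours] -/
theorem homLadder_kernels (hν : ∀ v, 0 < ν v) (hν1 : ∑ v, ν v = 1) (hM0 : ∀ u v, M 0 u v = ν v)
    (hidle : ∀ i : Fin K, ∀ u v, M i.succ u v = if v = u then 1 else 0) :
    (∀ k, IsRowStochastic (M k)) ∧ ∀ k, DetailedBalance ((fun _ : Fin (K + 1) => ν) k) (M k) := by
  constructor
  · intro k
    refine Fin.cases ?_ (fun i => ?_) k
    · exact ⟨fun u v => by rw [hM0]; exact (hν v).le, fun u => by simp_rw [hM0]; exact hν1⟩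
    · refine ⟨fun u v => by rw [hidle]; split_ifs <;> norm_num, fun u => ?_⟩
      simp_rw [hidle i]
      rw [Finset.sum_ite_eq' univ u]; simp
  · intro k
    refine Fin.cases ?_ (fun i => ?_) k
    · intro u v; simp only [hM0]; ring
    · intro u v
      simp only [hidle]
      by_cases huv : u = v
      · subst huv; rfl
      · rw [if_neg (fun h => huv h.symm), if_neg huv, mul_zero, mul_zero]

/-- **The homogeneous ladder is a transition matrix** (`0 ≤ t ≤ 1`, `w` a probability vector). [ours] -/
theorem homLadder_isRowStochastic (hν : ∀ v, 0 < ν v) (hν1 : ∑ v, ν v = 1) (hM0 : ∀ u v, M 0 u v = ν v)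
    (hidle : ∀ i : Fin K, ∀ u v, M i.succ u v = if v = u then 1 else 0) (hw0 : ∀ k, 0 ≤ w k) (hw1 : ∑ k, w k = 1) (ht0 : 0 ≤ t) (ht1 : t ≤ 1)
    (hP : ∀ x y, P x y = t * ptBareSwap (fun _ : Fin (K + 1) => ν) x y + (1 - t) * prodKernel w M x y) : IsRowStochastic P := by
  have hμ : ∀ (k : Fin (K + 1)) (v : S), 0 < (fun _ : Fin (K + 1) => ν) k v := fun _ v => hν v
  have h := weightedScheme_isRowStochastic (t := t) (w := w) (ptBareSwap_isRowStochastic hμ) (homLadder_kernels hν hν1 hM0 hidle).1 hw0 hw1 ht0 ht1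
  have e : P = fun x y => t * ptBareSwap (fun _ : Fin (K + 1) => ν) x y + (1 - t) * prodKernel w M x y := funext fun x => funext fun y => hP x y
  rw [e]; exact h

/-- **The homogeneous ladder is in detailed balance with `ν^{⊗(K+1)}`**, hence the product law is stationary. [ours] -/
theorem homLadder_detailedBalance (hν : ∀ v, 0 < ν v) (hν1 : ∑ v, ν v = 1) (hM0 : ∀ u v, M 0 u v = ν v)
    (hidle : ∀ i : Fin K, ∀ u v, M i.succ u v = if v = u then 1 else 0)
    (hP : ∀ x y, P x y = t * ptBareSwap (fun _ : Fin (K + 1) => ν) x y + (1 - t) * prodKernel w M x y) :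
    DetailedBalance (tensorFun (fun _ : Fin (K + 1) => ν)) P := by
  have hμ : ∀ (k : Fin (K + 1)) (v : S), 0 < (fun _ : Fin (K + 1) => ν) k v := fun _ v => hν v
  have h := weightedScheme_detailedBalance (w := w) (ptBareSwap_detailedBalance hμ) (homLadder_kernels hν hν1 hM0 hidle).2 t
  have e : P = fun x y => t * ptBareSwap (fun _ : Fin (K + 1) => ν) x y + (1 - t) * prodKernel w M x y := funext fun x => funext fun y => hP x y
  rw [e]; exact h

/-- A hot redraw has positive probability: `P(x, x[0↦v]) ≥ (1−t)w_0·ν(v)`. [ours] -/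
theorem homLadder_hot_pos (hν : ∀ v, 0 < ν v) (hν1 : ∑ v, ν v = 1) (hM0 : ∀ u v, M 0 u v = ν v)
    (hidle : ∀ i : Fin K, ∀ u v, M i.succ u v = if v = u then 1 else 0) (hw0 : ∀ k, 0 ≤ w k) (ht0 : 0 ≤ t) (ht1 : t ≤ 1)
    (hP : ∀ x y, P x y = t * ptBareSwap (fun _ : Fin (K + 1) => ν) x y + (1 - t) * prodKernel w M x y) (x : Fin (K + 1) → S) (v : S) :
    (1 - t) * w 0 * ν v ≤ P x (update x 0 v) := by
  have hμ : ∀ (k : Fin (K + 1)) (v : S), 0 < (fun _ : Fin (K + 1) => ν) k v := fun _ v => hν v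
  have hM := (homLadder_kernels hν hν1 hM0 hidle).1
  have hco : coordKernel M 0 x (update x 0 v) = ν v := by
    unfold coordKernel
    rw [update_self, if_pos rfl, hM0]
  have hpk : w 0 * ν v ≤ prodKernel w M x (update x 0 v) := by
    rw [prodKernel_apply, ← hco]
    exact Finset.single_le_sum (f := fun j => w j * coordKernel M j x (update x 0 v))
      (fun j _ => mul_nonneg (hw0 j) (coordKernel_nonneg M (fun j u v => (hM j).1 u v) j _ _)) (mem_univ 0)
  rw [hP]
  have hsw : 0 ≤ ptBareSwap (fun _ : Fin (K + 1) => ν) x (update x 0 v) := (ptBareSwap_isRowStochastic hμ).1 _ _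
  have h1t : 0 ≤ 1 - t := by linarith
  calc (1 - t) * w 0 * ν v = t * 0 + (1 - t) * (w 0 * ν v) := by ring
    _ ≤ t * ptBareSwap (fun _ : Fin (K + 1) => ν) x (update x 0 v) + (1 - t) * prodKernel w M x (update x 0 v) :=
        add_le_add (mul_le_mul_of_nonneg_left hsw ht0) (mul_le_mul_of_nonneg_left hpk h1t)

/-- An adjacent swap has positive probability: `P(x, x∘σ_l) ≥ t/K` (`K ≥ 1`). [ours] -/
theorem homLadder_swap_pos (hK : 1 ≤ K) (hν : ∀ v, 0 < ν v) (hν1 : ∑ v, ν v = 1) (hM0 : ∀ u v, M 0 u v = ν v)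
    (hidle : ∀ i : Fin K, ∀ u v, M i.succ u v = if v = u then 1 else 0) (hw0 : ∀ k, 0 ≤ w k) (hw1 : ∑ k, w k = 1) (ht0 : 0 ≤ t) (ht1 : t ≤ 1)
    (hP : ∀ x y, P x y = t * ptBareSwap (fun _ : Fin (K + 1) => ν) x y + (1 - t) * prodKernel w M x y) (x : Fin (K + 1) → S) (l : Fin K) :
    t / K ≤ P x (x ∘ levelSwap l) := by
  have hM := (homLadder_kernels hν hν1 hM0 hidle).1
  have hpk : 0 ≤ prodKernel w M x (x ∘ levelSwap l) := (prodKernel_isRowStochastic M w hw0 hw1 hM).1 _ _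
  rw [hP, ptBareSwap_const_eq_proposal hK hν]
  have hT := ptBareProposal_swap_ge l x
  have h1t : 0 ≤ 1 - t := by linarith
  calc t / K = t * (1 / K) + (1 - t) * 0 := by ring
    _ ≤ t * ptBareProposal x (x ∘ levelSwap l) + (1 - t) * prodKernel w M x (x ∘ levelSwap l) :=
        add_le_add (mul_le_mul_of_nonneg_left hT ht0) (mul_le_mul_of_nonneg_left hpk h1t)

/-- **THE HOMOGENEOUS LADDER IS IRREDUCIBLE** (`K ≥ 1`, `0 < t < 1`, `w_0 > 0`): a content is changed at the hot level by a redraw and carried to any level by accepted swaps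
(the conveyor identity `x[l+1 ↦ v] = ((x∘σ_l)[l ↦ v])∘σ_l`). [ours] -/
theorem homLadder_isIrreducible (hK : 1 ≤ K) (hν : ∀ v, 0 < ν v) (hν1 : ∑ v, ν v = 1) (hM0 : ∀ u v, M 0 u v = ν v)
    (hidle : ∀ i : Fin K, ∀ u v, M i.succ u v = if v = u then 1 else 0) (hw0 : ∀ k, 0 ≤ w k) (hw00 : 0 < w 0) (hw1 : ∑ k, w k = 1)
    (ht0 : 0 < t) (ht1 : t < 1)
    (hP : ∀ x y, P x y = t * ptBareSwap (fun _ : Fin (K + 1) => ν) x y + (1 - t) * prodKernel w M x y) : IsIrreducible P := by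
  have hP0 := (homLadder_isRowStochastic hν hν1 hM0 hidle hw0 hw1 ht0.le ht1.le hP).1
  have hKpos : (0 : ℝ) < K := Nat.cast_pos.mpr (by omega)
  refine isIrreducible_of_forall_closed hP0 fun T hT hcl => ?_
  -- (A) the hot coordinate
  have moveA : ∀ (x : Fin (K + 1) → S) (v : S), x ∈ T → update x 0 v ∈ T := by
    intro x v hx
    refine hcl x hx (update x 0 v) (lt_of_lt_of_le ?_ (homLadder_hot_pos hν hν1 hM0 hidle hw0 ht0.le ht1.le hP x v))
    exact mul_pos (mul_pos (by linarith) hw00) (hν v)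
  -- (B) swaps
  have swapPos : ∀ (x : Fin (K + 1) → S) (l : Fin K), x ∈ T → x ∘ levelSwap l ∈ T := by
    intro x l hx
    exact hcl x hx _ (lt_of_lt_of_le (div_pos ht0 hKpos) (homLadder_swap_pos hK hν hν1 hM0 hidle hw0 hw1 ht0.le ht1.le hP x l))
  -- (C) every coordinate, by the conveyor identity
  have moveC : ∀ (k : Fin (K + 1)) (x : Fin (K + 1) → S), x ∈ T → ∀ v, update x k v ∈ T := by
    intro k
    induction k using Fin.induction with
    | zero => exact fun x hx v => moveA x v hx
    | succ l ih =>
      intro x hx v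
      rw [update_succ_eq_swap_update_swap]
      exact swapPos _ l (ih _ (swapPos x l hx) v)
  -- (D) everything
  obtain ⟨x₀, hx₀⟩ := hT
  have key : ∀ (y : Fin (K + 1) → S) (s : Finset (Fin (K + 1))), s.piecewise y x₀ ∈ T := by
    intro y s
    induction s using Finset.induction_on with
    | empty => rwa [Finset.piecewise_empty]
    | insert k s hk ih =>
      rw [Finset.piecewise_insert]
      exact moveC k _ ih _
  refine Finset.eq_univ_of_forall fun y => ?_
  have := key y univ
  rwa [Finset.piecewise_univ] at this

/-- **THE HOMOGENEOUS LADDER IS APERIODIC:** `P(x,x) ≥ (1−t)w_0·ν(x_0) > 0` (`t < 1`, `w_0 > 0`). [ours] -/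
theorem homLadder_isAperiodic (hν : ∀ v, 0 < ν v) (hν1 : ∑ v, ν v = 1) (hM0 : ∀ u v, M 0 u v = ν v)
    (hidle : ∀ i : Fin K, ∀ u v, M i.succ u v = if v = u then 1 else 0) (hw0 : ∀ k, 0 ≤ w k) (hw00 : 0 < w 0) (ht0 : 0 ≤ t) (ht1 : t < 1)
    (hP : ∀ x y, P x y = t * ptBareSwap (fun _ : Fin (K + 1) => ν) x y + (1 - t) * prodKernel w M x y) : IsAperiodic P := by
  refine isAperiodic_of_diag_pos fun x => ?_
  have h := homLadder_hot_pos hν hν1 hM0 hidle hw0 ht0 ht1.le hP x (x 0)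
  rw [update_eq_self] at h
  exact lt_of_lt_of_le (mul_pos (mul_pos (by linarith) hw00) (hν (x 0))) h

/-- **THE HOMOGENEOUS LADDER CONVERGES:** for every `ε > 0` it is `ε`-close to `ν^{⊗(K+1)}` at some time (LPW Thm 4.9). [ours] -/
theorem homLadder_exists_worstTvDist_le (hK : 1 ≤ K) (hν : ∀ v, 0 < ν v) (hν1 : ∑ v, ν v = 1) (hM0 : ∀ u v, M 0 u v = ν v)
    (hidle : ∀ i : Fin K, ∀ u v, M i.succ u v = if v = u then 1 else 0) (hw0 : ∀ k, 0 ≤ w k) (hw00 : 0 < w 0) (hw1 : ∑ k, w k = 1)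
    (ht0 : 0 < t) (ht1 : t < 1)
    (hP : ∀ x y, P x y = t * ptBareSwap (fun _ : Fin (K + 1) => ν) x y + (1 - t) * prodKernel w M x y) {ε : ℝ} (hε : 0 < ε) :
    ∃ n, worstTvDist P (tensorFun (fun _ : Fin (K + 1) => ν)) n ≤ ε := by
  have hμ : ∀ (k : Fin (K + 1)) (v : S), 0 < (fun _ : Fin (K + 1) => ν) k v := fun _ v => hν v
  have hPst := homLadder_isRowStochastic hν hν1 hM0 hidle hw0 hw1 ht0.le ht1.le hP
  exact exists_worstTvDist_le hPst (homLadder_isIrreducible hK hν hν1 hM0 hidle hw0 hw00 hw1 ht0 ht1 hP)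
    (homLadder_isAperiodic hν hν1 hM0 hidle hw0 hw00 ht0.le ht1 hP) ((homLadder_detailedBalance hν hν1 hM0 hidle hP).isStationary hPst.2)
    (fun x => (tensorFun_pos hμ x).le) (sum_tensorFun_eq_one _ fun _ => hν1) hε

/-! ## §2 The floor -/

omit [DecidableEq S] in
/-- The centred indicator `a = 𝟙{· = u} − ν(u)` has `ν`-mean zero (`Σν = 1`). [ours] -/
theorem centredIndicator_mean [DecidableEq S] (hν1 : ∑ v, ν v = 1) (u : S) :
    ∑ v, ν v * ((if v = u then (1 : ℝ) else 0) - ν u) = 0 := by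
  simp_rw [mul_sub, sum_sub_distrib, mul_ite, mul_one, mul_zero]
  rw [Finset.sum_ite_eq' univ u, if_pos (mem_univ _), ← sum_mul, hν1, one_mul, sub_self]

omit [Fintype S] [DecidableEq S] in
/-- Two values of the centred indicator differ by at most one: `(a(v) − a(v'))² ≤ 1`. [ours] -/
theorem centredIndicator_diff_sq_le [DecidableEq S] (ν : S → ℝ) (u v v' : S) :
    (((if v = u then (1 : ℝ) else 0) - ν u) - ((if v' = u then (1 : ℝ) else 0) - ν u)) ^ 2 ≤ 1 := by
  have e : ((if v = u then (1 : ℝ) else 0) - ν u) - ((if v' = u then (1 : ℝ) else 0) - ν u)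
      = (if v = u then (1 : ℝ) else 0) - (if v' = u then (1 : ℝ) else 0) := by ring
  rw [e]
  split_ifs <;> norm_num

/-- **THE FLOOR AT A ROBIN ROOT:** for the homogeneous ladder (`K ≥ 1`, `0 < t < 1`, `w_0 > 0`, `ν > 0` with `ν(u) ≤ ½`) and a root `θ ∈ (0, π/(2K+1))` of the hot-end equation
with `h = (1−t)w_0`, `ρ = (2t/K)(1 − cos θ)`: **`((1−ρ)/ρ)·log(√(K+1)/(24√5)) ≤ t_mix(1/4)`** (chapter AF file 1 at `δ = 0` with the exact eigenfunction of file 2,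
`R ≤ 5(K+1)ρ`, `D² = 5(K+1)`, `|Φ(u,…,u)| ≥ (K+1)/6`). [ours] -/
theorem homLadder_mode_mixingTime_ge (hK : 1 ≤ K) (hν : ∀ v, 0 < ν v) (hν1 : ∑ v, ν v = 1) (hM0 : ∀ u v, M 0 u v = ν v)
    (hidle : ∀ i : Fin K, ∀ u v, M i.succ u v = if v = u then 1 else 0) (hw0 : ∀ k, 0 ≤ w k) (hw00 : 0 < w 0) (hw1 : ∑ k, w k = 1)
    (ht0 : 0 < t) (ht1 : t < 1)
    (hP : ∀ x y, P x y = t * ptBareSwap (fun _ : Fin (K + 1) => ν) x y + (1 - t) * prodKernel w M x y) (u : S) (hu : ν u ≤ 1 / 2)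
    {θ ρ : ℝ} (hθ0 : 0 < θ) (hθ1 : θ * (2 * K + 1) < π)
    (hrobin : (1 - t) * w 0 * Real.cos (θ * ((K : ℝ) + 1 / 2)) = t / K * (Real.cos (θ * ((K : ℝ) + 1 / 2)) - Real.cos (θ * ((K : ℝ) + 3 / 2))))
    (hρ : ρ = 2 * t / K * (1 - Real.cos θ)) :
    (1 - ρ) / ρ * Real.log (Real.sqrt ((K : ℝ) + 1) / (24 * Real.sqrt 5)) ≤ (mixingTime P (tensorFun (fun _ : Fin (K + 1) => ν)) (1 / 4) : ℝ) := by
  have hμ : ∀ (k : Fin (K + 1)) (v : S), 0 < (fun _ : Fin (K + 1) => ν) k v := fun _ v => hν v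
  have hKpos : (0 : ℝ) < K := Nat.cast_pos.mpr (by omega)
  -- the mode
  set c : ℕ → ℝ := fun n => Real.cos (θ * ((K : ℝ) + 1 / 2 - n)) with hc_def
  have hc : ∀ n : ℕ, c n = Real.cos (θ * ((K : ℝ) + 1 / 2 - n)) := fun n => rfl
  have hρ0 := robinMode_rho_pos hK ht0 hθ0 hθ1 hρ
  have hρ1 := ((robinMode_rho_lt hK ht0 hθ0 hθ1 hρ).2 ht1.le)
  -- the statistic
  set a : S → ℝ := fun v => (if v = u then (1 : ℝ) else 0) - ν u with ha_def
  set Φ : (Fin (K + 1) → S) → ℝ := fun x => ∑ k : Fin (K + 1), c k * a (x k) with hΦ_def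
  have hΦ : ∀ x, Φ x = ∑ k : Fin (K + 1), c k * a (x k) := fun x => rfl
  have ha0 : ∑ v, ν v * a v = 0 := centredIndicator_mean hν1 u
  have ha : ∀ v v', (a v - a v') ^ 2 ≤ 1 := fun v v' => centredIndicator_diff_sq_le ν u v v'
  -- exact eigenfunction
  have heig : ∀ x, ∑ y, P x y * Φ y = (1 - ρ) * Φ x :=
    homLadder_oneLevel_eigen hK hν hν1 hM0 hidle hw1 hP ha0 hΦ (robinMode_robin hc hρ hrobin) (fun n _ => robinMode_interior hc hρ n)
      (robinMode_neumann hK hc hρ)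
  have heig' : ∀ x, |∑ y, P x y * Φ y - (1 - ρ) * Φ x| ≤ 0 := fun x => by rw [heig x, sub_self, abs_zero]
  -- increments
  set R : ℝ := t * θ ^ 2 + (1 - t) * w 0 * c 0 ^ 2 with hR_def
  have hR : ∀ x, ∑ y, P x y * (Φ y - Φ x) ^ 2 ≤ R := fun x =>
    homLadder_oneLevel_increment_le hK hν hν1 hM0 hidle (hw0 0) hw1 ht0.le ht1.le hP hΦ (robinMode_c_diff_sq_le hc) ha x
  have hR0 : 0 ≤ R := by rw [hR_def]; have := hw0 0; positivity
  have hRρ : R ≤ 5 * ((K : ℝ) + 1) * ρ := robinMode_increment_le hK ht0 hθ0 hθ1 hc hρ hrobin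
  -- the constant `D`
  set D : ℝ := Real.sqrt (5 * ((K : ℝ) + 1)) with hD_def
  have hD0 : 0 < D := Real.sqrt_pos.mpr (by positivity)
  have hD2 : D ^ 2 = 5 * ((K : ℝ) + 1) := by rw [hD_def, Real.sq_sqrt (by positivity)]
  have hD : (R + 2 * (0 : ℝ) ^ 2 / (1 - (1 - ρ))) / (1 - (1 - ρ)) ≤ D ^ 2 := by
    rw [hD2, show 1 - (1 - ρ) = ρ by ring, show R + 2 * (0 : ℝ) ^ 2 / ρ = R by simp, div_le_iff₀ hρ0]
    exact hRρ
  -- the chain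
  have hPst := homLadder_isRowStochastic hν hν1 hM0 hidle hw0 hw1 ht0.le ht1.le hP
  have hst := (homLadder_detailedBalance hν hν1 hM0 hidle hP).isStationary hPst.2
  have hmix := homLadder_exists_worstTvDist_le hK hν hν1 hM0 hidle hw0 hw00 hw1 ht0 ht1 hP (show (0 : ℝ) < 1 / 4 by norm_num)
  have hπ0 : ∀ x, 0 ≤ tensorFun (fun _ : Fin (K + 1) => ν) x := fun x => (tensorFun_pos hμ x).le
  have hπ1 : ∑ x, tensorFun (fun _ : Fin (K + 1) => ν) x = 1 := sum_tensorFun_eq_one _ fun _ => hν1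
  -- Wilson's bound with a zero defect
  have hW := approxEigen_mixingTime_ge (Φ := Φ) (lam := 1 - ρ) (δ := 0) (R := R) hPst heig' (by linarith) (by linarith) hR0 hR hπ0 hπ1 hst hmix hD0 hD
    (fun _ : Fin (K + 1) => u)
  -- the start: `Φ(u,…,u) = (1 − ν u)·Σ_k c_k ≥ (K+1)/6`
  have hsum := robinMode_sum_ge hK hθ0 hθ1 hc
  have hΦ0 : ((K : ℝ) + 1) / 6 ≤ Φ (fun _ : Fin (K + 1) => u) := by
    have e : Φ (fun _ : Fin (K + 1) => u) = (1 - ν u) * ∑ k : Fin (K + 1), c k := by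
      rw [hΦ, mul_sum]
      exact sum_congr rfl fun k _ => by rw [ha_def]; simp only [if_true]; ring
    rw [e]
    nlinarith
  have hΦ0pos : 0 < Φ (fun _ : Fin (K + 1) => u) := lt_of_lt_of_le (by positivity) hΦ0
  -- compare the logarithms
  have e1 : 2 * (0 : ℝ) / (1 - (1 - ρ)) + 4 * D = 4 * D := by ring
  rw [e1, show (1 - ρ) / (1 - (1 - ρ)) = (1 - ρ) / ρ by ring, abs_of_pos hΦ0pos] at hW
  have hlog : Real.log (Real.sqrt ((K : ℝ) + 1) / (24 * Real.sqrt 5)) ≤ Real.log (Φ (fun _ : Fin (K + 1) => u) / (4 * D)) := by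
    have h5 : 0 < Real.sqrt 5 := Real.sqrt_pos.mpr (by norm_num)
    have hK1 : 0 < Real.sqrt ((K : ℝ) + 1) := Real.sqrt_pos.mpr (by positivity)
    refine Real.log_le_log (by positivity) ?_
    -- `√(K+1)/(24√5) ≤ ((K+1)/6)/(4√(5(K+1)))`
    have hDprod : D = Real.sqrt 5 * Real.sqrt ((K : ℝ) + 1) := by rw [hD_def, Real.sqrt_mul (by norm_num)]
    rw [hDprod, div_le_div_iff₀ (by positivity) (by positivity)]
    have hss : Real.sqrt ((K : ℝ) + 1) * Real.sqrt ((K : ℝ) + 1) = (K : ℝ) + 1 := Real.mul_self_sqrt (by positivity)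
    nlinarith [mul_pos h5 hK1]
  have hcoef : 0 ≤ (1 - ρ) / ρ := div_nonneg (by linarith) hρ0.le
  exact le_trans (mul_le_mul_of_nonneg_left hlog hcoef) hW

/-- **THE HOMOGENEOUS LADDER'S LAW-FREE `K³·log K` FLOOR:** `K ≥ 2`, `0 < t < 1`, `w` a probability vector with `w_0 > 0`, one positive law `ν` at every level with some `ν(u) ≤ ½`, exact hot
sampler, idle cold kernels; then **`(K(2K+1)²/(π²t) − 1)·(½·log(K+1) − log(24√5)) ≤ t_mix(1/4)`** — for EVERY hot rate `(1−t)w_0`, unconditionally in the chain. [ours] -/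
theorem homLadder_mixingTime_ge (hK : 2 ≤ K) (hν : ∀ v, 0 < ν v) (hν1 : ∑ v, ν v = 1) (hM0 : ∀ u v, M 0 u v = ν v)
    (hidle : ∀ i : Fin K, ∀ u v, M i.succ u v = if v = u then 1 else 0) (hw0 : ∀ k, 0 ≤ w k) (hw00 : 0 < w 0) (hw1 : ∑ k, w k = 1)
    (ht0 : 0 < t) (ht1 : t < 1)
    (hP : ∀ x y, P x y = t * ptBareSwap (fun _ : Fin (K + 1) => ν) x y + (1 - t) * prodKernel w M x y) (u : S) (hu : ν u ≤ 1 / 2) :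
    ((K : ℝ) * (2 * K + 1) ^ 2 / (π ^ 2 * t) - 1) * (Real.log ((K : ℝ) + 1) / 2 - Real.log (24 * Real.sqrt 5))
      ≤ (mixingTime P (tensorFun (fun _ : Fin (K + 1) => ν)) (1 / 4) : ℝ) := by
  have hK1 : 1 ≤ K := by omega
  have hK2 : (2 : ℝ) ≤ K := by exact_mod_cast hK
  obtain ⟨θ, hθ0, hθ1, hrobin⟩ := robinMode_exists (t := t) (h := (1 - t) * w 0) hK1 ht0 (mul_pos (by linarith) hw00)
  set ρ : ℝ := 2 * t / K * (1 - Real.cos θ) with hρ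
  have hmode := homLadder_mode_mixingTime_ge hK1 hν hν1 hM0 hidle hw0 hw00 hw1 ht0 ht1 hP u hu hθ0 hθ1 hrobin hρ
  have hρ0 := robinMode_rho_pos hK1 ht0 hθ0 hθ1 hρ
  have hρK := robinMode_rho_mul_le hK1 ht0 hθ0 hθ1 hρ
  -- the logarithm: `log(√(K+1)/(24√5)) = ½·log(K+1) − log(24√5)`
  have hlog : Real.log (Real.sqrt ((K : ℝ) + 1) / (24 * Real.sqrt 5)) = Real.log ((K : ℝ) + 1) / 2 - Real.log (24 * Real.sqrt 5) := by
    have h5 : 0 < Real.sqrt 5 := Real.sqrt_pos.mpr (by norm_num)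
    rw [Real.log_div (Real.sqrt_pos.mpr (by positivity)).ne' (by positivity), Real.log_sqrt (by positivity)]
  rw [← hlog]
  -- the coefficient: `K(2K+1)²/(π²t) − 1 ≤ (1−ρ)/ρ`, and it is non-negative for `K ≥ 2`
  have hpi : π ^ 2 < 9.93 := by nlinarith [Real.pi_lt_d2, Real.pi_pos]
  have hcoef : (K : ℝ) * (2 * K + 1) ^ 2 / (π ^ 2 * t) - 1 ≤ (1 - ρ) / ρ := by
    have h1 : (K : ℝ) * (2 * K + 1) ^ 2 ≤ t * π ^ 2 / ρ := by
      rw [le_div_iff₀ hρ0]; nlinarith [hρK]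
    have h2 : (K : ℝ) * (2 * K + 1) ^ 2 / (π ^ 2 * t) ≤ 1 / ρ := by
      rw [div_le_iff₀ (by positivity)]
      calc (K : ℝ) * (2 * K + 1) ^ 2 ≤ t * π ^ 2 / ρ := h1
        _ = 1 / ρ * (π ^ 2 * t) := by ring
    have h3 : (1 - ρ) / ρ = 1 / ρ - 1 := by field_simp
    rw [h3]; linarith
  have hcoef0 : 0 ≤ (K : ℝ) * (2 * K + 1) ^ 2 / (π ^ 2 * t) - 1 := by
    rw [sub_nonneg, le_div_iff₀ (by positivity)]
    nlinarith
  by_cases hB : 0 ≤ Real.log (Real.sqrt ((K : ℝ) + 1) / (24 * Real.sqrt 5))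
  · exact le_trans (mul_le_mul_of_nonneg_right hcoef hB) hmode
  · push Not at hB
    exact le_trans (mul_nonpos_of_nonneg_of_nonpos hcoef0 hB.le) (Nat.cast_nonneg _)

/-- The same floor with the kernel written out: `P = t·ptBareSwap ν^{⊗} + (1−t)·prodKernel w M`. [ours] -/
theorem homLadder_mixingTime_ge_lambda (hK : 2 ≤ K) (hν : ∀ v, 0 < ν v) (hν1 : ∑ v, ν v = 1) (hM0 : ∀ u v, M 0 u v = ν v)
    (hidle : ∀ i : Fin K, ∀ u v, M i.succ u v = if v = u then 1 else 0) (hw0 : ∀ k, 0 ≤ w k) (hw00 : 0 < w 0) (hw1 : ∑ k, w k = 1)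
    (ht0 : 0 < t) (ht1 : t < 1) (u : S) (hu : ν u ≤ 1 / 2) :
    ((K : ℝ) * (2 * K + 1) ^ 2 / (π ^ 2 * t) - 1) * (Real.log ((K : ℝ) + 1) / 2 - Real.log (24 * Real.sqrt 5))
      ≤ (mixingTime (fun x y : Fin (K + 1) → S => t * ptBareSwap (fun _ : Fin (K + 1) => ν) x y + (1 - t) * prodKernel w M x y)
          (tensorFun (fun _ : Fin (K + 1) => ν)) (1 / 4) : ℝ) :=
  homLadder_mixingTime_ge hK hν hν1 hM0 hidle hw0 hw00 hw1 ht0 ht1 (fun _ _ => rfl) u hu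

/-- **THE SAME FOR CHAPTER R'S SAMPLER `ptBareSampler t ν^{⊗} M`** (uniform update weights `1/(K+1)`, hot rate `(1−t)/(K+1)`): `K ≥ 2`, `0 < t < 1`, exact hot sampler, idle cold kernels,
some `ν(u) ≤ ½` ⇒ **`(K(2K+1)²/(π²t) − 1)·(½·log(K+1) − log(24√5)) ≤ t_mix(1/4)`**. [ours] -/
theorem ptBareSampler_hom_mixingTime_ge (hK : 2 ≤ K) (hν : ∀ v, 0 < ν v) (hν1 : ∑ v, ν v = 1) (hM0 : ∀ u v, M 0 u v = ν v)
    (hidle : ∀ i : Fin K, ∀ u v, M i.succ u v = if v = u then 1 else 0) (ht0 : 0 < t) (ht1 : t < 1) (u : S) (hu : ν u ≤ 1 / 2) :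
    ((K : ℝ) * (2 * K + 1) ^ 2 / (π ^ 2 * t) - 1) * (Real.log ((K : ℝ) + 1) / 2 - Real.log (24 * Real.sqrt 5))
      ≤ (mixingTime (ptBareSampler t (fun _ : Fin (K + 1) => ν) M) (tensorFun (fun _ : Fin (K + 1) => ν)) (1 / 4) : ℝ) :=
  homLadder_mixingTime_ge (w := fun _ : Fin (K + 1) => (1 : ℝ) / (K + 1)) hK hν hν1 hM0 hidle (fun _ => by positivity) (by positivity)
    (sum_uniform_weight K) ht0 ht1 (fun x y => ptBareSampler_apply t _ M x y) u hu

end Summit.Ventures.LatticeQCDFlow.Scaling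

end
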